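import Summits.NavierStokesRegularity.FluidComputer.LeraySupClock
import Literature.Analysis.FluidPDE.NSSereginL3BlowupHolds
import Literature.Analysis.FluidPDE.ClassicalEarlyWindowBound
import Literature.Analysis.FunctionSpaces.FourierSobolevNormEmbeddingProofs
import HarnessLib

/-!
# Fluid computer — the CRITICAL FACE of the level dictionary, I: the `L³` norm diverges (L27)

HONEST FRAMING (cell `pub-fluidc`, verbatim): *low prior, high value-of-information experiment on Tao's
machine paradigm; NOT a claim that NS blows up.* Theorem side of the cell; nothing here is evidence of blow-up.
The dictionary so far reads a realised finite-energy blow-up in SUBCRITICAL and SUPERCRITICAL currencies (block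
sups, block energies, fluxes, enstrophy, the sup norm, the energy) and in one critical one (the Besov
`Ḃ^{-1}_{∞,∞}` floor of Cheskidov–Shvydkoy, L1–L4: large level Reynolds numbers at infinitely many levels). This
module adds the strongest CRITICAL statement in print, in the class of every other entry. For every maximal smooth
solution `(u, p)` of the unforced Navier–Stokes system on `ℝ³ × [0, T)` (`ν > 0`; classical on `[0, T)`, no smooth
extension past `T`) which is Leray–Hopf from `u 0`:

* `eLpNorm_three_tendsto_top` (**L27 — THE CRITICAL DIVERGENCE**, Seregin 2012, Thm. 1.1, sharpening the
  `limsup` of Escauriaza–Seregin–Šverák 2003): `‖u(t)‖_{L³} → ∞` as `t ↑ T` — a genuine limit. The tree's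
  rendering `seregin_L3_blowup_holds` (ns.S08, PROVED in the tree) carries two extra hypotheses — an `L³` datum and
  essential boundedness on every closed sub-strip `[0, T'] × ℝ³` — which the dictionary's class does not have at
  `t = 0`; both are DISCHARGED here exactly as for Leray's sup clock (L21): restart at an a.e.-good time `s`
  (`IsLerayHopfOn.exists_isLerayHopfOn_restart_Ioo`; the translate is maximal, `IsMaximalSmoothSolution.translate_zero`),
  the translate being bounded on closed sub-strips by far-field ε-regularity plus compact continuity
  (`LeraySupClock.eLpNorm_uncurry_translate_lt_top`) and its datum `u(s) ∈ L² ∩ L^∞ ⊂ L³` (`memLp_three_slice`).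
* `exists_window_eLpNorm_three_gt` (**L27, window form**): for every `M` there is `t₁ < T` with `‖u(t)‖_{L³} > M`
  for ALL `t ∈ (t₁, T)` — the divergence holds on a whole terminal window, not along a sequence of times.
* `eHomSobolevSeminorm_half_tendsto_top` (**L27′ — the `Ḣ^{1/2}` form**, Fujita–Kato's currency): the
  `Ḣ^{1/2}` seminorm of `u(t)` tends to `∞` as `t ↑ T`, through the critical embedding `Ḣ^{1/2}(ℝ³) ⊂ L³(ℝ³)`
  (`eLpNorm_three_le_eHomSobolevSeminorm_half_holds`, Bahouri–Chemin–Danchin Thm. 1.38, PROVED in the tree).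

Reading. `L³` and `Ḣ^{1/2}` are SCALE-INVARIANT: `u ↦ λu(λ²t, λx)` leaves both norms unchanged, so unlike every
clock of the time face (L19–L26, each ∝ a positive power of `ν` times a negative power of `T − t`) these statements
carry NO rate and NO constant — they say that a realised blow-up cannot be "one eddy that shrinks": a
self-similarly collapsing profile of fixed `L³` size is excluded; the critical size itself must diverge. The
companion modules give the instantaneous critical FLOOR (`CriticalFloor`, Kato: `‖u(t)‖_{L³} > δν` at every instant)
and the LEVEL-CURRENCY forms (`CriticalLevels`: `Σ_j 2^{j/2} ‖Δ̇_j u(t)‖₂ → ∞`, which dominates the enstrophy-tail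
divergence L26). HONEST SIZE NOTE: qualitative (a limit), no rate is claimed — none is known. Necessity only;
nothing about sufficiency. 0 sorry; no new definitions, no named facts.

## References

* G. Seregin, *A certain necessary condition of potential blow up for Navier–Stokes equations*,
  Comm. Math. Phys. 312 (2012) 833–845, Thm. 1.1. [Seregin2012]
* L. Escauriaza, G. Seregin, V. Šverák, Russ. Math. Surveys 58:2 (2003) 211–250, Thms. 1.3–1.4.
  [EscauriazaSereginSverak2003]
* H. Bahouri, J.-Y. Chemin, R. Danchin, *Fourier Analysis and Nonlinear PDE*, Springer 2011, Thm. 1.38.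
  [BahouriCheminDanchin2011]
* P. G. Lemarié-Rieusset, *The Navier–Stokes Problem in the 21st Century*, CRC 2016, Thm. 15.5 and proof of
  Thm. 14.5. [LemarieRieusset2016]
-/

noncomputable section

open MeasureTheory Set Function Filter Topology Metric
open scoped ENNReal NNReal
open Literature.Analysis.FluidPDE Literature.Analysis.FunctionSpaces
open Summit.NavierStokesRegularity.FluidComputer.LeraySupClock

namespace Summit.NavierStokesRegularity.FluidComputer.CriticalDivergence

/-! ## Interior slices are `L³` fields -/

/-- **Every interior slice of a classical Leray–Hopf solution is an `L³` field.** For a classical solution of the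
unforced system on `ℝ³ × [0, T)` (`ν > 0`), Leray–Hopf from `u 0`, and `t ∈ (0, T)`: `u(t) ∈ L³(ℝ³)` — it is in `L²`
(energy class) and bounded (`LeraySupClock.exists_bound_window`: far-field ε-regularity plus compact continuity),
and `L² ∩ L^∞ ⊂ L³` (`memLp_three_of_memLp_two_of_norm_le`).
[cite: LemarieRieusset2016, proof of Thm. 14.5 (p. 512) with Thm. 14.4 (p. 505)] -/
theorem memLp_three_slice {ν T : ℝ} (hν : 0 < ν) (hT : 0 < T)
    {u : ℝ → EuclideanSpace ℝ (Fin 3) → EuclideanSpace ℝ (Fin 3)} {p : ℝ → EuclideanSpace ℝ (Fin 3) → ℝ}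
    (hcl : IsClassicalNSSolutionOn (Ico 0 T) ν 0 u p) (hLH : IsLerayHopfOn T ν 0 (u 0) u)
    {t : ℝ} (ht : t ∈ Ioo 0 T) : MemLp (u t) 3 volume := by
  obtain ⟨M, hM⟩ := exists_bound_window hν hT hcl hLH ht.1 (T' := t) ht.2
  exact memLp_three_of_memLp_two_of_norm_le (hLH.memLp t ⟨ht.1.le, ht.2.le⟩)
    (fun x => hM t ⟨le_rfl, le_rfl⟩ x)

/-! ## L27: the `L³` norm diverges at the lifespan -/

/-- **L27 — THE CRITICAL DIVERGENCE** (Seregin 2012, Thm. 1.1). For every `ν > 0`, `T > 0` and every maximal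
smooth solution `(u, p)` of the unforced Navier–Stokes system on `ℝ³ × [0, T)` which is Leray–Hopf from `u 0`:
`‖u(t)‖_{L³(ℝ³)} → ∞` as `t ↑ T` (a genuine limit in `[0, ∞]`, along the whole left neighbourhood filter of `T`).
The tree's `seregin_L3_blowup_holds` applied to the restart at an a.e.-good time `s ∈ (0, T/2)`
(`IsLerayHopfOn.exists_isLerayHopfOn_restart_Ioo`; a maximal smooth solution of lifespan `T − s`,
`IsMaximalSmoothSolution.translate_zero`, from the `L³` field `u(s)`, `memLp_three_slice`, essentially bounded on
every closed sub-strip, `LeraySupClock.eLpNorm_uncurry_translate_lt_top`), then carried back along `t ↦ t − s`.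
No rate: the statement is scale-invariant. [cite: Seregin2012, Thm. 1.1]
[cite: EscauriazaSereginSverak2003, Thms. 1.3–1.4] -/
theorem eLpNorm_three_tendsto_top {ν T : ℝ} (hν : 0 < ν) (hT : 0 < T)
    {u : ℝ → EuclideanSpace ℝ (Fin 3) → EuclideanSpace ℝ (Fin 3)} {p : ℝ → EuclideanSpace ℝ (Fin 3) → ℝ}
    (hmax : IsMaximalSmoothSolution ν 0 u p T) (hLH : IsLerayHopfOn T ν 0 (u 0) u) :
    Tendsto (fun t => eLpNorm (u t) 3 volume) (𝓝[<] T) (𝓝 ∞) := by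
  -- restart at an a.e.-good time `s ∈ (T/4, T/2)`
  obtain ⟨s, hs, hLHs⟩ := hLH.exists_isLerayHopfOn_restart_Ioo hν.le (a := T / 4) (b := T / 2)
    (by positivity) (by linarith) (by linarith)
  have hs0 : 0 < s := by linarith [hs.1]
  have hsT : s < T := by linarith [hs.2]
  have hmaxs := hmax.translate_zero hs0 hsT
  have hLHs' : IsLerayHopfOn (T - s) ν 0 ((fun t => u (t + s)) 0) (fun t => u (t + s)) := by
    simpa only [zero_add] using hLHs
  have h₃ : MemLp ((fun t => u (t + s)) 0) 3 volume := by
    simpa only [zero_add] using memLp_three_slice hν hT hmax.1 hLH ⟨hs0, hsT⟩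
  have hbdd : ∀ T' ∈ Ioo 0 (T - s),
      eLpNorm (uncurry fun t => u (t + s)) ∞ (volume.restrict (Icc 0 T' ×ˢ univ)) < ∞ :=
    fun T' hT' => eLpNorm_uncurry_translate_lt_top hν hT hmax.1 hLH ⟨hs0, hsT⟩ hT'
  have hS := seregin_L3_blowup_holds hν (sub_pos.2 hsT) hmaxs hLHs' h₃ hbdd
  -- carry back along `t ↦ t - s`, which maps `𝓝[<] T` to `𝓝[<] (T - s)`
  have hφ : Tendsto (fun t : ℝ => t - s) (𝓝[<] T) (𝓝[<] (T - s)) := by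
    refine (continuous_sub_right s).continuousWithinAt.tendsto_nhdsWithin fun t ht => ?_
    simp only [mem_Iio] at ht ⊢
    linarith
  refine (hS.comp hφ).congr fun t => ?_
  simp only [Function.comp_apply, sub_add_cancel]

/-- **L27, WINDOW FORM.** Along every maximal smooth Leray–Hopf solution of the unforced system (`ν > 0`): for
every `M` there is `t₁ < T` such that `‖u(t)‖_{L³} > M` for ALL `t ∈ (t₁, T)` — the critical size exceeds every
bound on a whole terminal window (unfolding of the left-neighbourhood filter in `eLpNorm_three_tendsto_top`).
[cite: Seregin2012, Thm. 1.1] -/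
theorem exists_window_eLpNorm_three_gt {ν T : ℝ} (hν : 0 < ν) (hT : 0 < T)
    {u : ℝ → EuclideanSpace ℝ (Fin 3) → EuclideanSpace ℝ (Fin 3)} {p : ℝ → EuclideanSpace ℝ (Fin 3) → ℝ}
    (hmax : IsMaximalSmoothSolution ν 0 u p T) (hLH : IsLerayHopfOn T ν 0 (u 0) u) (M : ℝ≥0) :
    ∃ t₁ < T, ∀ t ∈ Ioo t₁ T, (M : ℝ≥0∞) < eLpNorm (u t) 3 volume := by
  have h := ENNReal.tendsto_nhds_top_iff_nnreal.1 (eLpNorm_three_tendsto_top hν hT hmax hLH) M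
  obtain ⟨t₁, ht₁, hsub⟩ := mem_nhdsLT_iff_exists_Ioo_subset.1 h
  exact ⟨t₁, ht₁, fun t ht => hsub ht⟩

/-! ## L27′: the `Ḣ^{1/2}` form -/

/-- **L27′ — THE CRITICAL DIVERGENCE IN FUJITA–KATO'S CURRENCY.** Along every maximal smooth Leray–Hopf solution
of the unforced system (`ν > 0`), the homogeneous Sobolev seminorm `‖u(t)‖_{Ḣ^{1/2}}` (the tree's
`Function.eHomSobolevSeminorm (1/2)` of the complexified slice, the `Ḣ^{1/2} ∩ L²` seminorm of ns.S14) tends to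
`∞` as `t ↑ T`: by the critical embedding `‖f‖_{L³} ≤ C ‖f‖_{Ḣ^{1/2}}` for `L²` fields
(`eLpNorm_three_le_eHomSobolevSeminorm_half_holds`, read through the isometry `complexify`) and L27. Both currencies
are scale-invariant; no rate. [cite: BahouriCheminDanchin2011, Thm. 1.38] [cite: Seregin2012, Thm. 1.1] -/
theorem eHomSobolevSeminorm_half_tendsto_top {ν T : ℝ} (hν : 0 < ν) (hT : 0 < T)
    {u : ℝ → EuclideanSpace ℝ (Fin 3) → EuclideanSpace ℝ (Fin 3)} {p : ℝ → EuclideanSpace ℝ (Fin 3) → ℝ}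
    (hmax : IsMaximalSmoothSolution ν 0 u p T) (hLH : IsLerayHopfOn T ν 0 (u 0) u) :
    Tendsto (fun t => Function.eHomSobolevSeminorm (1 / 2 : ℝ) (EuclideanSpace.complexify ∘ u t))
      (𝓝[<] T) (𝓝 ∞) := by
  obtain ⟨C, hC⟩ := @Literature.Analysis.FunctionSpaces.eLpNorm_three_le_eHomSobolevSeminorm_half_holds
    (EuclideanSpace ℂ (Fin 3)) _ _ _
  have h3 := eLpNorm_three_tendsto_top hν hT hmax hLH
  -- on `(0, T)` the embedding bounds `‖u(t)‖₃` by `C ‖u(t)‖_{Ḣ^{1/2}}`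
  have hle : ∀ᶠ t in 𝓝[<] T, eLpNorm (u t) 3 volume ≤
      C * Function.eHomSobolevSeminorm (1 / 2 : ℝ) (EuclideanSpace.complexify ∘ u t) := by
    filter_upwards [Ioo_mem_nhdsLT hT] with t ht
    have h2 : MemLp (EuclideanSpace.complexify ∘ u t) 2 volume :=
      memLp_complexify_comp (hLH.memLp t ⟨ht.1.le, ht.2.le⟩)
    have hnorm : eLpNorm (u t) 3 volume = eLpNorm (EuclideanSpace.complexify ∘ u t) 3 volume :=
      eLpNorm_congr_norm_ae (Eventually.of_forall fun x => (EuclideanSpace.norm_complexify (u t x)).symm)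
    rw [hnorm]
    exact hC _ h2
  -- `C · (Ḣ^{1/2} seminorm) → ∞`, hence the seminorm itself
  have hC3 : Tendsto (fun t => (C : ℝ≥0∞) *
      Function.eHomSobolevSeminorm (1 / 2 : ℝ) (EuclideanSpace.complexify ∘ u t)) (𝓝[<] T) (𝓝 ∞) :=
    tendsto_nhds_top_mono h3 hle
  refine ENNReal.tendsto_nhds_top_iff_nnreal.2 fun M => ?_
  have hev := ENNReal.tendsto_nhds_top_iff_nnreal.1 hC3 (C * M)
  filter_upwards [hev] with t ht
  by_contra hle'
  rw [not_lt] at hle'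
  have : (C : ℝ≥0∞) * Function.eHomSobolevSeminorm (1 / 2 : ℝ) (EuclideanSpace.complexify ∘ u t) ≤
      (C : ℝ≥0∞) * (M : ℝ≥0∞) := mul_le_mul' le_rfl hle'
  rw [← ENNReal.coe_mul] at this
  exact absurd (ht.trans_le this) (lt_irrefl _)

end Summit.NavierStokesRegularity.FluidComputer.CriticalDivergence

end
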